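import Summits.Ventures.Crystal3D.Theorems.StickyWulffConstantCoaxialWallLawBarlowNoEntry
import Summits.Ventures.Crystal3D.Theorems.StickyWulffConstantTextureLiminfTexShadowWordThreading
import HarnessLib

/-!
# NO ENTRY into a receiving plate related to the root frame by a WORD: the `hPexcl0` clause for word-related pairs ((β)-lite B2)
# (lane T, crux `TextureLiminfV5`, stmt-Ventures-23912, line `TexShadow` v8.22, re-targeted `stub_terraceCensus`; 19480-p1 g20)

HONEST FRAMING. Venture `Summits/Ventures/Crystal3D` (cell `crystal3d-full`), route `route-Ventures-StickyWulffConstant`, helper `--supports` the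
law-v5 crux `TextureLiminfV5` (stmt-Ventures-23912), lane T.  Registry-free, version-free, census-free: the hypothesis `hPexcl0` of the plate-abstract
word-net counts `word_family_endPairs_plates` / `word_endPairs_multi_plates` (p694150), discharged for a receiving plate whose deep balls are FULL in a
frame `G₂` (or in one of two frames `G₂`, `G₂'`) whose slot dozen is a WORD image of the root dozen — the (β)-lite replacement of '…BarlowNoEntry'
`hPexcl0_of_fullTwinPlate` (which is the one-letter basal-twin case).  Nothing about energies; F-C1 not moved.  Memo BETA-LITE-g20 §4 (B2).

* **`hPexcl0_of_wordPlate`** — word data `(F, u, WF)` over any base frame, a reduced admissible word `w₀` with the root IN-PLANE for one of its letters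
  (`⟪u [], m⟫ = 0`, `m ∈ w₀`), a receiving set `P₂` of balls FULL in `G₂` with `G₂ '' S = wordFrame (F []) w₀ '' S`: no well-formed class reads an
  occupied `60°` face at a ball of `P₂`, for every state invariant (an occupied face at a full ball is a face of the `G₂`-dozen by `shell_slot_of_full`,
  and `word_noTop_of_inner_zero_word`, '…TexShadowWordThreading' p736971);
* `hPexcl0_of_wordPlate_lattice` — the same with the dozen hypothesis on LATTICES (`G₂ '' Λ₀ = wordFrame (F []) w₀ '' Λ₀`);
* `hPexcl0_of_twoWordPlates` — receiving balls each full in `G₂` OR in `G₂'`, both word images (`w₀`, `w₀'`) with the root in-plane for a letter of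
  each: the shape needed when the receiving plate's locally-fcc layers come in the two bilayer orientations.  (Balls of the receiving plate with an hcp
  dozen — twin READINGS — are B2′ of the memo and are NOT treated here.)
WHAT THIS IS NOT: not the count, not the sources, not the certificate; F-C1 not moved.
-/

noncomputable section

namespace Summit.Ventures.Crystal3D.Theorems

open Summit.Ventures.Crystal3D Finset
open Literature.MathematicalPhysics.StatisticalMechanics (fccStacking)
open Summit.Ventures.Crystal3D.Cruxes.TextureLiminf.TexShadow (E3)
open scoped InnerProductSpace

section NoEntryWord

variable {X : Finset E3} (hX : ∀ p ∈ X, ∀ q ∈ X, p ≠ q → 1 ≤ dist p q)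
  {F : List E3 → (E3 ≃ₗᵢ[ℝ] E3)} {u : List E3 → E3} {WF : List E3 → Prop}
  (hFc : ∀ μ κ, F (μ :: κ) = ((ℝ ∙ μ)ᗮ.reflection).trans (F κ))
  (huc : ∀ μ κ, u (μ :: κ) = -u κ)
  (hWFc : ∀ μ κ, WF (μ :: κ) ↔ (WF κ ∧ ‖μ‖ = 1 ∧
    (∀ w ∈ fccSlots, ⟪w, μ⟫_ℝ = 0 ∨ ⟪w, μ⟫_ℝ = Real.sqrt (2 / 3) ∨ ⟪w, μ⟫_ℝ = -Real.sqrt (2 / 3)) ∧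
    ⟪u κ, μ⟫_ℝ = Real.sqrt (2 / 3) ∧ ∀ μ' κ', κ = μ' :: κ' → μ' ≠ -μ))
  {w₀ : List E3}
  (hw₀l : ∀ μ ∈ w₀, ‖μ‖ = 1 ∧
    ∀ w ∈ fccSlots, ⟪w, μ⟫_ℝ = 0 ∨ ⟪w, μ⟫_ℝ = Real.sqrt (2 / 3) ∨ ⟪w, μ⟫_ℝ = -Real.sqrt (2 / 3))
  (hw₀c : List.IsChain (fun μ μ' => ⟪μ, μ'⟫_ℝ = 1 / 3 ∨ ⟪μ, μ'⟫_ℝ = -1 / 3) w₀)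
  {m : E3} (hm : m ∈ w₀) (horth : ⟪u [], m⟫_ℝ = 0)

include hX hFc huc hWFc hw₀l hw₀c hm horth

/-- **`hPexcl0` for a receiving plate FULL in a word image of the root dozen**: no well-formed class of a root in-plane for a letter of `w₀`
reads an occupied `60°` face at a ball of `P₂` — for every state invariant `P`. -/
theorem hPexcl0_of_wordPlate (G₂ : E3 ≃ₗᵢ[ℝ] E3)
    (hG₂ : (G₂ : E3 → E3) '' ↑fccSlots = (wordFrame (F []) w₀ : E3 → E3) '' ↑fccSlots)
    {P₂ : Finset E3} (hP₂full : ∀ b ∈ P₂, IsFull X G₂ b) (P : E3 × List E3 → Prop) :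
    ∀ (b : E3) (κ : List E3), WF κ → P (b, κ) → b ∈ P₂ →
      (∃ a ∈ fccSlots, ∃ a' ∈ fccSlots, ∃ a'' ∈ fccSlots,
        ⟪a, a'⟫_ℝ = 1 / 2 ∧ ⟪a, a''⟫_ℝ = 1 / 2 ∧ ⟪a', a''⟫_ℝ = 1 / 2 ∧
        b + F κ a ∈ X ∧ b + F κ a' ∈ X ∧ b + F κ a'' ∈ X) → False := by
  intro b κ hκ _ hb htri
  have hGfull := hP₂full b hb
  obtain ⟨a, ha, a', ha', a'', ha'', i1, i2, i3, h1, h2, h3⟩ := htri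
  refine word_noTop_of_inner_zero_word hFc huc hWFc hw₀l hw₀c hm horth G₂ hG₂ hκ
    ⟨a, ha, a', ha', a'', ha'', i1, i2, i3, ?_, ?_, ?_⟩
  · exact shell_slot_of_full hX G₂ hGfull h1 (by rw [LinearIsometryEquiv.norm_map, norm_eq_one_of_mem_fccSlots ha])
  · exact shell_slot_of_full hX G₂ hGfull h2 (by rw [LinearIsometryEquiv.norm_map, norm_eq_one_of_mem_fccSlots ha'])
  · exact shell_slot_of_full hX G₂ hGfull h3 (by rw [LinearIsometryEquiv.norm_map, norm_eq_one_of_mem_fccSlots ha''])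

/-- **Lattice form** of `hPexcl0_of_wordPlate`: the dozen hypothesis stated as `G₂ '' Λ₀ = wordFrame (F []) w₀ '' Λ₀` (the shape of the relating
word in `CensusDominatedAt` / `SigmaNineSliverAt`). -/
theorem hPexcl0_of_wordPlate_lattice (G₂ : E3 ≃ₗᵢ[ℝ] E3)
    (hG₂ : G₂ '' fccStacking 1 (Real.sqrt (2 / 3)) = wordFrame (F []) w₀ '' fccStacking 1 (Real.sqrt (2 / 3)))
    {P₂ : Finset E3} (hP₂full : ∀ b ∈ P₂, IsFull X G₂ b) (P : E3 × List E3 → Prop) :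
    ∀ (b : E3) (κ : List E3), WF κ → P (b, κ) → b ∈ P₂ →
      (∃ a ∈ fccSlots, ∃ a' ∈ fccSlots, ∃ a'' ∈ fccSlots,
        ⟪a, a'⟫_ℝ = 1 / 2 ∧ ⟪a, a''⟫_ℝ = 1 / 2 ∧ ⟪a', a''⟫_ℝ = 1 / 2 ∧
        b + F κ a ∈ X ∧ b + F κ a' ∈ X ∧ b + F κ a'' ∈ X) → False :=
  hPexcl0_of_wordPlate hX hFc huc hWFc hw₀l hw₀c hm horth G₂ (image_fccSlots_eq_of_image_fcc_eq _ _ hG₂) hP₂full P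

end NoEntryWord

section NoEntryTwoWords

variable {X : Finset E3} (hX : ∀ p ∈ X, ∀ q ∈ X, p ≠ q → 1 ≤ dist p q)
  {F : List E3 → (E3 ≃ₗᵢ[ℝ] E3)} {u : List E3 → E3} {WF : List E3 → Prop}
  (hFc : ∀ μ κ, F (μ :: κ) = ((ℝ ∙ μ)ᗮ.reflection).trans (F κ))
  (huc : ∀ μ κ, u (μ :: κ) = -u κ)
  (hWFc : ∀ μ κ, WF (μ :: κ) ↔ (WF κ ∧ ‖μ‖ = 1 ∧
    (∀ w ∈ fccSlots, ⟪w, μ⟫_ℝ = 0 ∨ ⟪w, μ⟫_ℝ = Real.sqrt (2 / 3) ∨ ⟪w, μ⟫_ℝ = -Real.sqrt (2 / 3)) ∧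
    ⟪u κ, μ⟫_ℝ = Real.sqrt (2 / 3) ∧ ∀ μ' κ', κ = μ' :: κ' → μ' ≠ -μ))

include hX hFc huc hWFc

/-- **Two receiving orientations**: every ball of `P₂` is full in `G₂` or in `G₂'`, both slot dozens are word images of the root dozen (words `w₀`,
`w₀'`), and the root is in-plane for a letter of EACH word — then `hPexcl0` holds for every invariant. -/
theorem hPexcl0_of_twoWordPlates
    {w₀ : List E3}
    (hw₀l : ∀ μ ∈ w₀, ‖μ‖ = 1 ∧
      ∀ w ∈ fccSlots, ⟪w, μ⟫_ℝ = 0 ∨ ⟪w, μ⟫_ℝ = Real.sqrt (2 / 3) ∨ ⟪w, μ⟫_ℝ = -Real.sqrt (2 / 3))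
    (hw₀c : List.IsChain (fun μ μ' => ⟪μ, μ'⟫_ℝ = 1 / 3 ∨ ⟪μ, μ'⟫_ℝ = -1 / 3) w₀)
    {m : E3} (hm : m ∈ w₀) (horth : ⟪u [], m⟫_ℝ = 0)
    {w₀' : List E3}
    (hw₀'l : ∀ μ ∈ w₀', ‖μ‖ = 1 ∧
      ∀ w ∈ fccSlots, ⟪w, μ⟫_ℝ = 0 ∨ ⟪w, μ⟫_ℝ = Real.sqrt (2 / 3) ∨ ⟪w, μ⟫_ℝ = -Real.sqrt (2 / 3))
    (hw₀'c : List.IsChain (fun μ μ' => ⟪μ, μ'⟫_ℝ = 1 / 3 ∨ ⟪μ, μ'⟫_ℝ = -1 / 3) w₀')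
    {m' : E3} (hm' : m' ∈ w₀') (horth' : ⟪u [], m'⟫_ℝ = 0)
    (G₂ G₂' : E3 ≃ₗᵢ[ℝ] E3)
    (hG₂ : (G₂ : E3 → E3) '' ↑fccSlots = (wordFrame (F []) w₀ : E3 → E3) '' ↑fccSlots)
    (hG₂' : (G₂' : E3 → E3) '' ↑fccSlots = (wordFrame (F []) w₀' : E3 → E3) '' ↑fccSlots)
    {P₂ : Finset E3} (hP₂full : ∀ b ∈ P₂, IsFull X G₂ b ∨ IsFull X G₂' b) (P : E3 × List E3 → Prop) :
    ∀ (b : E3) (κ : List E3), WF κ → P (b, κ) → b ∈ P₂ →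
      (∃ a ∈ fccSlots, ∃ a' ∈ fccSlots, ∃ a'' ∈ fccSlots,
        ⟪a, a'⟫_ℝ = 1 / 2 ∧ ⟪a, a''⟫_ℝ = 1 / 2 ∧ ⟪a', a''⟫_ℝ = 1 / 2 ∧
        b + F κ a ∈ X ∧ b + F κ a' ∈ X ∧ b + F κ a'' ∈ X) → False := by
  classical
  intro b κ hκ hP hb htri
  rcases hP₂full b hb with hfull | hfull
  · exact hPexcl0_of_wordPlate hX hFc huc hWFc hw₀l hw₀c hm horth G₂ hG₂ (P₂ := P₂.filter fun b => IsFull X G₂ b)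
      (fun b' hb' => (mem_filter.1 hb').2) P b κ hκ hP (mem_filter.2 ⟨hb, hfull⟩) htri
  · exact hPexcl0_of_wordPlate hX hFc huc hWFc hw₀'l hw₀'c hm' horth' G₂' hG₂' (P₂ := P₂.filter fun b => IsFull X G₂' b)
      (fun b' hb' => (mem_filter.1 hb').2) P b κ hκ hP (mem_filter.2 ⟨hb, hfull⟩) htri

end NoEntryTwoWords

end Summit.Ventures.Crystal3D.Theorems

end
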